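import Literature.NumberTheory.LFunctions.MoebiusWalshCircuits
import Literature.NumberTheory.LFunctions.MoebiusWalshSparseDyadic
import Literature.NumberTheory.LFunctions.MoebiusTwoPowerModuliProofs
import Literature.NumberTheory.LFunctions.MoebiusWalshKatai
import HarnessLib

/-!
# Green 2012, Proposition 1 for the Liouville function — the discharge of
# `green_liouville_fourierWalsh`

Topic `Literature/NumberTheory/LFunctions`. Everything in this file is PROVED; it discharges the
named fact `Literature.NumberTheory.LFunctions.green_liouville_fourierWalsh`
(`MoebiusWalshCircuits.lean`; B. Green, *On (not) computing the Möbius function using bounded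
depth circuits*, Combin. Probab. Comput. 21 (2012) 942–951, Proposition 1 with the §1 remark
"All of the results in this paper hold equally well for the Liouville function, with very similar
proofs"): there are absolute `c > 0`, `K` with
`|λ̂(S)| = |Σ_{x<2ⁿ} λ(x) ∏_{j∈S}(-1)^{x_j}|/2ⁿ ≤ K k e^{-c√n/k}` for all `n ≥ 1` and nonempty
`S ⊆ {0,…,n-1}`, `|S| = k` (`green_liouville_fourierWalsh_holds`).

## The assembly (Green, end of §3: "Proof of Proposition 1")

"Suppose that Proposition 1 fails. Then there is some `S` such that `|μ̂(S)| ≥ k e^{-cn^{1/2}/k}`.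
By Proposition 2 there is a sparse dyadic rational `θ`, `|r_i| ≪ e^{3cn^{1/2}/k}`, such that
`|μ̂(θ)| ≥ e^{-4cn^{1/2}}`. If `c` is chosen small enough, this is contrary to Proposition 3."
Inputs, all PROVED in the tree:
* Proposition 2 (Kátai's lemma): `Katai.exists_sparseDyadic_of_large_walshSum`
  (`MoebiusWalshKatai.lean`, stated directly for the cube sum `walshSum`);
* Proposition 3 for `λ`: `Green2012.liouville_sparse_dyadic` (`MoebiusWalshSparseDyadic.lean`:
  Corollaries 1–2, Lemma 1 and Proposition 3, from Proposition 4 for `λ`,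
  `MoebiusExpSum.liouville_minorArc` of `MoebiusExpSumMinorArc.lean`), fed with
* Theorem 3: `green_moebius_character_twoPower_holds` (`MoebiusTwoPowerModuliProofs.lean`).
Bookkeeping (`green_liouville_fourierWalsh_holds`): with `δ = K k e^{-c√n/k} < 1` (else trivial) and
`E = e^{c√n/k}` one has `Kk < E`, `E^k = e^{c√n}`; Kátai's radius is `R = ⌈64k²/δ²⌉ ≤ 256E²/K² + 1 ≤ E²`,
so `(2R+1)^k ≤ E^{3k} = e^{3c√n}` and the numerators are `≤ e^{2c√n} ≤ e^{c₁√n}`; sparsity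
`(k+1)² ≤ n` follows from `k log(Kk) < c√n`; the two bounds then force `e^{6c√n} ≤ K₁ < Kk < E ≤ e^{6c√n}`.
Constants: `c = c₁/10`, `K = max 131 (4K₁)` with `c₁ ≤ 1`, `K₁ ≥ 1` those of Proposition 3.

## References

* B. Green, Combin. Probab. Comput. 21 (2012) 942–951, §3 (Propositions 1–2) and §4
  (Proposition 3) [Green2012].
-/

noncomputable section

open Finset Real ArithmeticFunction
open scoped FourierTransform

namespace Literature.NumberTheory.LFunctions

namespace Green2012

/-- The trivial bound `|Σ_{x∈{0,1}ⁿ} g(val x) w_S(x)| ≤ 2ⁿ` for `|g| ≤ 1`. [folklore] -/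
theorem abs_walshSum_le {n : ℕ} (g : ℕ → ℤ) (hg : ∀ m, |(g m : ℝ)| ≤ 1) (S : Finset (Fin n)) :
    |walshSum g S| ≤ 2 ^ n := by
  unfold walshSum
  refine (Finset.abs_sum_le_sum_abs _ _).trans ?_
  calc ∑ x : Fin n → Bool, |(g (Literature.Computability.Complexity.bitsToNat (List.ofFn x)) : ℝ) *
          ∏ j ∈ S, (if x j = true then (-1 : ℝ) else 1)|
      ≤ ∑ _x : Fin n → Bool, (1 : ℝ) := Finset.sum_le_sum fun x _ => by
        rw [abs_mul]
        have h1 : |∏ j ∈ S, (if x j = true then (-1 : ℝ) else 1)| = 1 := by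
          rw [Finset.abs_prod]
          refine Finset.prod_eq_one fun j _ => ?_
          split_ifs <;> simp
        rw [h1, mul_one]
        exact hg _
    _ = 2 ^ n := by simp [Fintype.card_bool, Fintype.card_fin]

end Green2012

open Green2012 in
/-- **Green 2012, Proposition 1 for the Liouville function — PROVED**: there are absolute
`c > 0`, `K` such that for every `n ≥ 1` and every nonempty `S ⊆ {0,…,n-1}`, `|S| = k`,
`|λ̂(S)| = |Σ_{x<2ⁿ} λ(x) w_S(x)|/2ⁿ ≤ K k e^{-c√n/k}`. Proof as printed (Green, end of §3):
if `|λ̂(S)| ≥ δ := K k e^{-c√n/k}` (`< 1`, else trivial) then Kátai's lemma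
(`Katai.exists_sparseDyadic_of_large_walshSum`) gives a sparse dyadic `θ`, numerators `≤ R ≍ e^{2c√n/k}`,
with `|Σ λ(x)e(θx)| ≥ (δ/2)(2R+1)^{-k} 2ⁿ ≥ e^{-4c√n} 2ⁿ`, contradicting Proposition 3
(`liouville_sparse_dyadic`, fed with the tree's `green_moebius_character_twoPower_holds`),
`|Σ λ(x)e(θx)| ≤ K₁ e^{-c₁√n} 2ⁿ`, once `c = c₁/10` and `K ≥ 4K₁`; the sparsity `(k+1)² ≤ n` and
all sizes follow from `Kk < e^{c√n/k}`. [cite: Green2012, Proposition 1 and §1 (remark on λ)] -/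
theorem green_liouville_fourierWalsh_holds : green_liouville_fourierWalsh := by
  classical
  obtain ⟨c₀, hc₀, K₀, hK₀, hP3⟩ := liouville_sparse_dyadic green_moebius_character_twoPower_holds
  -- normalised constants `c₁ ≤ 1`, `K₁ ≥ 1`
  obtain ⟨c₁, hc₁⟩ : ∃ c₁ : ℝ, c₁ = min c₀ 1 := ⟨_, rfl⟩
  have hc₁0 : 0 < c₁ := by rw [hc₁]; exact lt_min hc₀ one_pos
  have hc₁1 : c₁ ≤ 1 := hc₁ ▸ min_le_right _ _
  have hc₁le : c₁ ≤ c₀ := hc₁ ▸ min_le_left _ _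
  obtain ⟨K₁, hK₁⟩ : ∃ K₁ : ℝ, K₁ = max K₀ 1 := ⟨_, rfl⟩
  have hK₁1 : 1 ≤ K₁ := hK₁ ▸ le_max_right _ _
  have hK₁ge : K₀ ≤ K₁ := hK₁ ▸ le_max_left _ _
  have hP3' : ∀ (n : ℕ) (r : Fin n → ℤ),
      ((Finset.univ.filter (fun i => r i ≠ 0)).card + 1) ^ 2 ≤ n →
      (∀ i, |(r i : ℝ)| ≤ Real.exp (c₁ * Real.sqrt n)) →
      ‖expSum (fun x => (liouville x : ℝ)) (2 ^ n) (dyadic r)‖ ≤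
        K₁ * 2 ^ n * Real.exp (-(c₁ * Real.sqrt n)) := by
    intro n r hk hr
    have hs0 : 0 ≤ Real.sqrt n := Real.sqrt_nonneg _
    have hcs := mul_le_mul_of_nonneg_right hc₁le hs0
    have h := hP3 n r hk (fun i => (hr i).trans (Real.exp_le_exp.mpr hcs))
    refine h.trans ?_
    have : Real.exp (-(c₀ * Real.sqrt n)) ≤ Real.exp (-(c₁ * Real.sqrt n)) :=
      Real.exp_le_exp.mpr (by linarith only [hcs])
    gcongr
  obtain ⟨c, hc⟩ : ∃ c : ℝ, c = c₁ / 10 := ⟨_, rfl⟩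
  have hc0 : 0 < c := by rw [hc]; positivity
  obtain ⟨K, hK⟩ : ∃ K : ℝ, K = max 131 (4 * K₁) := ⟨_, rfl⟩
  have hK131 : 131 ≤ K := hK ▸ le_max_left _ _
  have hK4 : 4 * K₁ ≤ K := hK ▸ le_max_right _ _
  refine ⟨c, hc0, K, fun n hn S hS => ?_⟩
  obtain ⟨k, hk⟩ : ∃ k : ℕ, k = S.card := ⟨_, rfl⟩
  rw [← hk]
  have hk1 : 1 ≤ k := hk ▸ Finset.card_pos.mpr hS
  have hk0 : (0 : ℝ) < k := by exact_mod_cast hk1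
  have hk1' : (1 : ℝ) ≤ k := by exact_mod_cast hk1
  have hN0 : (0 : ℝ) < (2 : ℝ) ^ n := by positivity
  obtain ⟨s, hs⟩ : ∃ s : ℝ, s = Real.sqrt n := ⟨_, rfl⟩
  rw [← hs]
  have hs0 : 0 ≤ s := hs ▸ Real.sqrt_nonneg _
  -- the trivial bound
  have hliou1 : ∀ m, |(liouville m : ℝ)| ≤ 1 := fun m => LiouvilleSum.abs_liouville_le_one m
  have hW : |walshSum (fun m => liouville m) S| ≤ 2 ^ n := abs_walshSum_le _ hliou1 S
  have hW1 : |walshSum (fun m => liouville m) S| / 2 ^ n ≤ 1 := by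
    rw [div_le_one hN0]; exact hW
  by_cases hB : 1 ≤ K * k * Real.exp (-(c * s / k))
  · exact hW1.trans hB
  push Not at hB
  by_contra hcon
  push Not at hcon
  -- `E = e^{cs/k}`: `Kk < E`, `E ≤ e^{cs}`, `E^k = e^{cs}`
  obtain ⟨E, hE⟩ : ∃ E : ℝ, E = Real.exp (c * s / k) := ⟨_, rfl⟩
  have hE0 : 0 < E := hE ▸ Real.exp_pos _
  have hEinv : Real.exp (-(c * s / k)) = 1 / E := by rw [hE, Real.exp_neg, one_div]
  have hKkE : K * k < E := by
    rw [hEinv] at hB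
    rw [mul_one_div, div_lt_one hE0] at hB
    exact hB
  have hKk' : K ≤ K * k := by
    calc K = K * 1 := (mul_one _).symm
      _ ≤ K * k := mul_le_mul_of_nonneg_left hk1' (by linarith only [hK131])
  have hKk : 131 ≤ K * k := hK131.trans hKk'
  have hE131 : 131 < E := lt_of_le_of_lt hKk hKkE
  have hE1 : 1 ≤ E := by linarith
  have hEk : E ^ k = Real.exp (c * s) := by
    rw [hE, ← Real.exp_nat_mul]; congr 1; field_simp
  have hEle : E ≤ Real.exp (c * s) := by
    rw [← hEk]; exact le_self_pow₀ hE1 (by omega)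
  -- sparsity: `k < cs ≤ s/10`, so `(k+1)² ≤ n`
  have hklog : (k : ℝ) * Real.log (K * k) < c * s := by
    have h1 : Real.log (K * k) < c * s / k := by
      rw [Real.log_lt_iff_lt_exp (by linarith), ← hE]; exact hKkE
    rwa [lt_div_iff₀ hk0, mul_comm] at h1
  have hlog131 : 1 ≤ Real.log (K * k) := by
    rw [Real.le_log_iff_exp_le (by linarith)]
    have := Real.exp_one_lt_d9
    linarith
  have hkcs : (k : ℝ) < c * s := lt_of_le_of_lt (le_mul_of_one_le_right hk0.le hlog131) hklog
  have hks : 10 * (k : ℝ) < s := by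
    rw [hc] at hkcs
    have : c₁ / 10 * s ≤ 1 / 10 * s := by nlinarith [hc₁1, hs0]
    linarith
  have hsparse : (k + 1) ^ 2 ≤ n := by
    have h1 : ((k : ℝ) + 1) ^ 2 ≤ n := by
      have h2 : (k : ℝ) + 1 ≤ s := by linarith
      calc ((k : ℝ) + 1) ^ 2 ≤ s ^ 2 := pow_le_pow_left₀ (by positivity) h2 2
        _ = n := by rw [hs, Real.sq_sqrt (Nat.cast_nonneg n)]
    exact_mod_cast h1
  -- the density `δ = Kk/(2E)` for Kátai's lemma
  obtain ⟨δ, hδ⟩ : ∃ δ : ℝ, δ = K * k * Real.exp (-(c * s / k)) / 2 := ⟨_, rfl⟩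
  have hδE : δ = K * k / (2 * E) := by rw [hδ, hEinv]; field_simp
  have hδ0 : 0 < δ := by rw [hδE]; positivity
  -- the Walsh sum is large
  have hbig : δ * 2 ^ n ≤ |walshSum (fun m => liouville m) S| := by
    rw [lt_div_iff₀ hN0] at hcon
    have hK0 : 0 < K := by linarith
    have hx : 0 ≤ K * k * Real.exp (-(c * s / k)) * 2 ^ n := by positivity
    rw [hδ]; linarith
  obtain ⟨r₀, hrR, hlow⟩ := Katai.exists_sparseDyadic_of_large_walshSum (fun m => liouville m)
    (fun m => by
      have h := hliou1 m
      have e : ((liouville m : ℤ) : ℝ) = ((liouville m : ℤ) : ℝ) := rfl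
      rw [← Int.cast_abs] at h
      exact_mod_cast h) S hS hδ0 hbig
  rw [← hk] at hrR hlow
  obtain ⟨R, hR⟩ : ∃ R : ℕ, R = Katai.kataiR k δ := ⟨_, rfl⟩
  rw [← hR] at hrR hlow
  -- the digit-indexed numerators, supported on `S`
  obtain ⟨r, hr⟩ : ∃ r : Fin n → ℤ, r = fun i => if i ∈ S then r₀ i else 0 := ⟨_, rfl⟩
  have hr0 : ∀ i, i ∉ S → r i = 0 := fun i hi => by rw [hr]; dsimp only; rw [if_neg hi]
  have hrS : ∀ i, i ∈ S → r i = r₀ i := fun i hi => by rw [hr]; dsimp only; rw [if_pos hi]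
  -- `R ≤ E²`
  have hK0 : (0 : ℝ) < K := by linarith only [hK131]
  have hRle : (R : ℝ) ≤ E ^ 2 := by
    have h1 : (R : ℝ) < 64 * (k : ℝ) ^ 2 / δ ^ 2 + 1 := by
      rw [hR, Katai.kataiR]; exact Nat.ceil_lt_add_one (by positivity)
    have h2 : 64 * (k : ℝ) ^ 2 / δ ^ 2 = 256 * E ^ 2 / K ^ 2 := by
      rw [hδE]; field_simp; ring
    rw [h2] at h1
    -- `256 E²/K² + 1 ≤ E²` since `K ≥ 131`, `E ≥ 131`
    have hE2 : 0 < E ^ 2 := pow_pos hE0 2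
    have hK2 : (512 : ℝ) ≤ K ^ 2 := by nlinarith only [hK131]
    have h3 : 256 * E ^ 2 / K ^ 2 ≤ E ^ 2 / 2 := by
      rw [div_le_div_iff₀ (by positivity) two_pos]
      nlinarith only [hE2, hK2]
    have h4 : (2 : ℝ) ≤ E ^ 2 := by nlinarith only [hE131]
    linarith only [h1, h3, h4]
  -- (b) numerators `≤ R ≤ E² ≤ e^{2cs} ≤ e^{c₁ s}`
  have hrexp : ∀ i, |(r i : ℝ)| ≤ Real.exp (c₁ * s) := by
    intro i
    have h1 : |(r i : ℝ)| ≤ R := by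
      by_cases hi : i ∈ S
      · rw [hrS i hi]; exact_mod_cast hrR i hi
      · rw [hr0 i hi]; simp
    refine h1.trans (hRle.trans ?_)
    calc E ^ 2 ≤ Real.exp (c * s) ^ 2 := pow_le_pow_left₀ hE0.le hEle 2
      _ = Real.exp (2 * c * s) := by rw [← Real.exp_nat_mul]; congr 1; push_cast; ring
      _ ≤ Real.exp (c₁ * s) := Real.exp_le_exp.mpr (by rw [hc]; nlinarith only [hc₁0, hs0])
  -- (a) sparsity of `r`
  have hsupp : ((Finset.univ.filter (fun i => r i ≠ 0)).card + 1) ^ 2 ≤ n := by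
    have hsub : Finset.univ.filter (fun i => r i ≠ 0) ⊆ S := by
      intro i hi
      rw [Finset.mem_filter] at hi
      by_contra h
      exact hi.2 (hr0 i h)
    have hcard : (Finset.univ.filter (fun i => r i ≠ 0)).card ≤ k := hk ▸ Finset.card_le_card hsub
    calc ((Finset.univ.filter (fun i => r i ≠ 0)).card + 1) ^ 2 ≤ (k + 1) ^ 2 :=
          Nat.pow_le_pow_left (by omega) 2
      _ ≤ n := hsparse
  -- Proposition 3
  have hP := hP3' n r hsupp (by rw [← hs]; exact hrexp)
  rw [← hs] at hP
  -- Kátai's exponential sum is `expSum λ 2ⁿ (dyadic r)`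
  have hθ : ∑ j ∈ S, (r₀ j : ℝ) / 2 ^ ((j : ℕ) + 1) = dyadic r := by
    unfold dyadic
    rw [← Finset.sum_subset (Finset.subset_univ S) (fun i _ hi => by rw [hr0 i hi]; simp)]
    exact Finset.sum_congr rfl fun i hi => by rw [hrS i hi]
  have hsum : ∑ x ∈ range (2 ^ n), ((liouville x : ℤ) : ℂ) *
      (𝐞 ((∑ j ∈ S, (r₀ j : ℝ) / 2 ^ ((j : ℕ) + 1)) * x) : ℂ) =
      expSum (fun x => (liouville x : ℝ)) (2 ^ n) (dyadic r) := by
    rw [hθ]; unfold expSum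
    refine Finset.sum_congr rfl fun x _ => ?_
    push_cast; rfl
  rw [hsum] at hlow
  have hlow' : δ / 2 / (2 * (R : ℝ) + 1) ^ k * 2 ^ n ≤
      ‖expSum (fun x => (liouville x : ℝ)) (2 ^ n) (dyadic r)‖ := by
    refine le_trans (le_of_eq ?_) hlow
    ring
  -- compare: `δ/2/(2R+1)^k ≤ K₁ e^{-c₁ s}`
  have hcmp : δ / 2 / (2 * (R : ℝ) + 1) ^ k ≤ K₁ * Real.exp (-(c₁ * s)) := by
    have := hlow'.trans hP
    have h2 : δ / 2 / (2 * (R : ℝ) + 1) ^ k * 2 ^ n ≤ (K₁ * Real.exp (-(c₁ * s))) * 2 ^ n := by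
      calc _ ≤ K₁ * 2 ^ n * Real.exp (-(c₁ * s)) := this
        _ = (K₁ * Real.exp (-(c₁ * s))) * 2 ^ n := by ring
    exact le_of_mul_le_mul_right h2 hN0
  -- lower bound: `δ/2 ≥ 1/E`, `(2R+1)^k ≤ (E³)^k = e^{3cs}`
  have hδlow : 1 / E ≤ δ / 2 := by
    have e : δ / 2 = K * k / (4 * E) := by rw [hδE]; ring
    rw [e, div_le_div_iff₀ hE0 (by positivity)]
    nlinarith only [hKk, hE0]
  have h2R1 : 2 * (R : ℝ) + 1 ≤ E ^ 3 := by
    have hE2 : 0 < E ^ 2 := pow_pos hE0 2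
    have : 2 * E ^ 2 + 1 ≤ E ^ 3 := by nlinarith only [hE131, hE2]
    linarith only [this, hRle]
  have hpowk : (2 * (R : ℝ) + 1) ^ k ≤ Real.exp (3 * c * s) := by
    calc (2 * (R : ℝ) + 1) ^ k ≤ (E ^ 3) ^ k := pow_le_pow_left₀ (by positivity) h2R1 k
      _ = (E ^ k) ^ 3 := by ring
      _ = Real.exp (3 * c * s) := by rw [hEk, ← Real.exp_nat_mul]; congr 1; push_cast; ring
  have hlower : Real.exp (-(4 * c * s)) ≤ δ / 2 / (2 * (R : ℝ) + 1) ^ k := by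
    rw [le_div_iff₀ (by positivity)]
    calc Real.exp (-(4 * c * s)) * (2 * (R : ℝ) + 1) ^ k
        ≤ Real.exp (-(4 * c * s)) * Real.exp (3 * c * s) :=
          mul_le_mul_of_nonneg_left hpowk (Real.exp_pos _).le
      _ = Real.exp (-(c * s)) := by rw [← Real.exp_add]; congr 1; ring
      _ ≤ 1 / E := by
          rw [Real.exp_neg, one_div]
          exact inv_anti₀ hE0 hEle
      _ ≤ δ / 2 := hδlow
  -- hence `e^{6cs} ≤ K₁`, contradicting `e^{6cs} ≥ E > Kk ≥ K ≥ 4K₁`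
  have h6 : Real.exp (6 * c * s) ≤ K₁ := by
    have h1 := hlower.trans hcmp
    rw [show -(c₁ * s) = -(4 * c * s) + -(6 * c * s) by rw [hc]; ring, Real.exp_add] at h1
    have h2 : Real.exp (-(4 * c * s)) * Real.exp (6 * c * s) * Real.exp (-(6 * c * s)) ≤
        K₁ * Real.exp (-(4 * c * s)) * Real.exp (-(6 * c * s)) := by
      calc _ = Real.exp (-(4 * c * s)) := by
            rw [mul_assoc, ← Real.exp_add]; simp
        _ ≤ K₁ * (Real.exp (-(4 * c * s)) * Real.exp (-(6 * c * s))) := h1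
        _ = _ := by ring
    have h3 := le_of_mul_le_mul_right h2 (Real.exp_pos _)
    have h4 : Real.exp (6 * c * s) * Real.exp (-(4 * c * s)) ≤ K₁ * Real.exp (-(4 * c * s)) := by
      linarith only [h3]
    exact le_of_mul_le_mul_right h4 (Real.exp_pos _)
  have hE6 : E ≤ Real.exp (6 * c * s) := by
    calc E ≤ Real.exp (c * s) := hEle
      _ ≤ Real.exp (6 * c * s) := Real.exp_le_exp.mpr (by nlinarith only [hc0, hs0])
  have hKK₁ : K₁ < K * k := by linarith only [hK4, hKk', hK₁1]
  linarith only [h6, hE6, hKkE, hKK₁]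


end Literature.NumberTheory.LFunctions
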